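import Literature.NumberTheory.Automorphic.OrdinaryCompletedCohomologyGL
import HarnessLib

/-!
# Tame levels contain the integral elements trivial at the bad places; factorisation of a scalar

(1) Every `g ∈ GL_n(𝒪̂_K)` with `g_w = 1` at the bad places lies in the tame level `U`
(`mem_subgroup_of_localComponent`): the partial products `∏_{w ∈ T} ι_w(g_w) ∈ U` (`ofLocal_mem`)
converge to `g` (`tendsto_of_eventually_localComponent_eq`: on `GL_n(𝒪̂_K)` the restricted product
topology is the product topology, Mathlib `RestrictedProduct.isEmbedding_structureMap`) and `U` is
closed — the placewise form of `U = U_S × ∏_{v ∉ S} GL_n(𝒪_v)` (Gee–Newton §2.1).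
(2) For `u ∈ 𝓞 K ∖ 0` a unit above `p` (`û_v`) with `ι_w(u · 1) ∈ U` at the bad places off `p`, the
principal scalar factors as `u · 1 = D · C · y`, `D = ∏_{v ∣ p} ⟨û_v,…,û_v⟩_v`,
`C = ∏_{w ∣ u, w ∉ S} t_{w,n}^{ord_w u}`, `y ∈ ⋂_r U(r)` (`scalarRemainder_mem_hidaLevel`). [folklore]
-/

open Literature.NumberTheory.Automorphic Literature.NumberTheory.Automorphic.BigHeckeGLn
open NumberField IsDedekindDomain Filter Topology

namespace Literature.NumberTheory.Automorphic.BigHeckeGLn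

variable {n : ℕ} {K : Type} [Field K] [NumberField K]

/-- In `𝒪̂_K ⊆ 𝔸_K^∞` a net whose components are eventually constant converges. [folklore] -/
theorem tendsto_finiteAdele_of_eventually_eq {α : Type*} {l : Filter α}
    {x : α → FiniteAdeleRing (𝓞 K) K} {y : FiniteAdeleRing (𝓞 K) K}
    (hx : ∀ a, x a ∈ integralFiniteAdeles K) (hy : y ∈ integralFiniteAdeles K)
    (h : ∀ w : HeightOneSpectrum (𝓞 K), ∀ᶠ a in l, x a w = y w) : Tendsto x l (𝓝 y) := by
  set X : α → ∀ w : HeightOneSpectrum (𝓞 K), (w.adicCompletionIntegers K : Set (w.adicCompletion K)) :=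
    fun a w => ⟨x a w, (mem_integralFiniteAdeles_iff.1 (hx a)) w⟩ with hX
  set Y : ∀ w : HeightOneSpectrum (𝓞 K), (w.adicCompletionIntegers K : Set (w.adicCompletion K)) :=
    fun w => ⟨y w, (mem_integralFiniteAdeles_iff.1 hy) w⟩ with hY
  have hxX : x = fun a => RestrictedProduct.structureMap (fun v : HeightOneSpectrum (𝓞 K) => v.adicCompletion K)
      (fun v => (v.adicCompletionIntegers K : Set (v.adicCompletion K))) cofinite (X a) := by
    funext a
    exact RestrictedProduct.ext _ _ fun w => rfl
  have hyY : y = RestrictedProduct.structureMap (fun v : HeightOneSpectrum (𝓞 K) => v.adicCompletion K)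
      (fun v => (v.adicCompletionIntegers K : Set (v.adicCompletion K))) cofinite Y :=
    RestrictedProduct.ext _ _ fun w => rfl
  rw [hxX, hyY]
  refine (RestrictedProduct.isEmbedding_structureMap.continuous.tendsto Y).comp ?_
  refine tendsto_pi_nhds.2 fun w => ?_
  refine (tendsto_const_nhds (x := Y w)).congr' ?_
  filter_upwards [h w] with a ha
  exact Subtype.ext ha.symm

/-- **Convergence in `GL_n(𝒪̂_K)` is placewise**: a net in `GL_n(𝒪̂_K)` whose local components
are eventually constant converges in `GL_n(𝔸_K^∞)`. [folklore] -/
theorem tendsto_of_eventually_localComponent_eq {α : Type*} {l : Filter α}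
    {F : α → FiniteAdelicGL n K} {g : FiniteAdelicGL n K}
    (hF : ∀ a, F a ∈ glFiniteIntegralLevel n K) (hg : g ∈ glFiniteIntegralLevel n K)
    (h : ∀ w : HeightOneSpectrum (𝓞 K), ∀ᶠ a in l, localComponent n K w (F a) = localComponent n K w g) :
    Tendsto F l (𝓝 g) := by
  -- the matrix entries of `F a` and of `(F a)⁻¹` converge placewise
  have hval : ∀ {G : α → FiniteAdelicGL n K} {g' : FiniteAdelicGL n K},
      (∀ a, G a ∈ glFiniteIntegralLevel n K) → g' ∈ glFiniteIntegralLevel n K →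
      (∀ w : HeightOneSpectrum (𝓞 K), ∀ᶠ a in l, localComponent n K w (G a) = localComponent n K w g') →
      Tendsto (fun a => ((G a : FiniteAdelicGL n K) : Matrix (Fin n) (Fin n) (FiniteAdeleRing (𝓞 K) K))) l
        (𝓝 (g' : Matrix (Fin n) (Fin n) (FiniteAdeleRing (𝓞 K) K))) := by
    intro G g' hG hg' hloc
    refine tendsto_pi_nhds.2 fun i => tendsto_pi_nhds.2 fun j => ?_
    refine tendsto_finiteAdele_of_eventually_eq (fun a => (mem_glFiniteIntegralLevel_iff.1 (hG a)).1 i j)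
      ((mem_glFiniteIntegralLevel_iff.1 hg').1 i j) fun w => ?_
    filter_upwards [hloc w] with a ha
    have := congrArg (fun M : GL (Fin n) (w.adicCompletion K) => (M : Matrix (Fin n) (Fin n) (w.adicCompletion K)) i j) ha
    simpa only [coe_localComponent_apply] using this
  rw [Units.isInducing_embedProduct.tendsto_nhds_iff]
  refine Tendsto.prodMk_nhds (hval hF hg h) ?_
  refine (MulOpposite.continuous_op.tendsto _).comp ?_
  refine hval (G := fun a => (F a)⁻¹) (fun a => inv_mem (hF a)) (inv_mem hg) fun w => ?_
  filter_upwards [h w] with a ha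
  rw [map_inv, map_inv, ha]

/-- An element of `GL_n(𝔸_K^∞)` all of whose local components lie in `GL_n(𝒪_w)` lies in
`GL_n(𝒪̂_K)`. [folklore] -/
theorem mem_glFiniteIntegralLevel_of_localComponent {g : FiniteAdelicGL n K}
    (h : ∀ w, localComponent n K w g ∈ valuedCongruenceSubgroup (Fin n) (1 : WithZero (Multiplicative ℤ))) :
    g ∈ glFiniteIntegralLevel n K := by
  refine mem_glFiniteIntegralLevel_iff.2 ⟨fun i j => ?_, fun i j => ?_⟩
  · refine mem_integralFiniteAdeles_iff.2 fun w => ?_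
    exact (HeightOneSpectrum.mem_adicCompletionIntegers (R := 𝓞 K) K w).2
      (((mem_valuedCongruenceSubgroup_iff (m := Fin n)).1 (h w)).1 i j)
  · refine mem_integralFiniteAdeles_iff.2 fun w => ?_
    have := ((mem_valuedCongruenceSubgroup_iff (m := Fin n)).1 (h w)).2.1 i j
    rw [← map_inv] at this
    exact (HeightOneSpectrum.mem_adicCompletionIntegers (R := 𝓞 K) K w).2 this

/-- Local components of a product of local elements at DISTINCT places. [folklore] -/
theorem localComponent_list_prod_ofLocal [DecidableEq (HeightOneSpectrum (𝓞 K))] (w : HeightOneSpectrum (𝓞 K))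
    (c : ∀ v : HeightOneSpectrum (𝓞 K), GL (Fin n) (v.adicCompletion K)) :
    ∀ l : List (HeightOneSpectrum (𝓞 K)), l.Nodup →
      localComponent n K w ((l.map fun v => ofLocal n K v (c v)).prod) = if w ∈ l then c w else 1
  | [], _ => by simp
  | v :: l, hl => by
    rw [List.map_cons, List.prod_cons, map_mul,
      localComponent_list_prod_ofLocal w c l (List.nodup_cons.1 hl).2]
    by_cases hvw : w = v
    · subst hvw
      rw [localComponent_ofLocal, if_neg (List.nodup_cons.1 hl).1, mul_one, if_pos List.mem_cons_self]
    · rw [localComponent_ofLocal_of_ne hvw, one_mul]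
      simp [hvw]

variable {p : ℕ} [Fact p.Prime] (𝒰 : TameLevel n K p)

/-- **A tame level contains every element of `GL_n(𝒪̂_K)` trivial at the bad places.** [folklore] -/
theorem mem_subgroup_of_localComponent {g : FiniteAdelicGL n K}
    (hgood : ∀ w, w ∉ 𝒰.bad → localComponent n K w g ∈
      valuedCongruenceSubgroup (Fin n) (1 : WithZero (Multiplicative ℤ)))
    (hbad : ∀ w ∈ 𝒰.bad, localComponent n K w g = 1) : g ∈ 𝒰.subgroup := by
  classical
  have hall : ∀ w, localComponent n K w g ∈ valuedCongruenceSubgroup (Fin n) (1 : WithZero (Multiplicative ℤ)) := by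
    intro w
    by_cases hw : w ∈ 𝒰.bad
    · rw [hbad w hw]; exact one_mem _
    · exact hgood w hw
  set F : Finset (HeightOneSpectrum (𝓞 K)) → FiniteAdelicGL n K :=
    fun T => (T.toList.map fun w => ofLocal n K w (localComponent n K w g)).prod with hFdef
  have hFmem : ∀ T, F T ∈ 𝒰.subgroup := by
    intro T
    refine list_prod_mem fun x hx => ?_
    obtain ⟨w, -, rfl⟩ := List.mem_map.1 hx
    by_cases hw : w ∈ 𝒰.bad
    · rw [hbad w hw, map_one]; exact one_mem _
    · exact 𝒰.ofLocal_mem w hw _ (hgood w hw)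
  have hFloc : ∀ T w, localComponent n K w (F T) = if w ∈ T then localComponent n K w g else 1 := by
    intro T w
    rw [hFdef, localComponent_list_prod_ofLocal w (fun v => localComponent n K v g) T.toList (Finset.nodup_toList T)]
    simp only [Finset.mem_toList]
  have hg : g ∈ glFiniteIntegralLevel n K := mem_glFiniteIntegralLevel_of_localComponent hall
  have ht : Tendsto F atTop (𝓝 g) :=
    tendsto_of_eventually_localComponent_eq (fun T => 𝒰.le_glFiniteIntegralLevel (hFmem T)) hg fun w => by
      filter_upwards [eventually_ge_atTop ({w} : Finset (HeightOneSpectrum (𝓞 K)))] with T hT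
      rw [hFloc, if_pos (hT (Finset.mem_singleton_self w))]
  exact (Subgroup.isClosed_of_isOpen _ 𝒰.isOpen).mem_of_tendsto ht (Eventually.of_forall hFmem)

/-- **Placewise membership in a tame level**: `g ∈ U` as soon as `g_w ∈ GL_n(𝒪_w)` for the good
places `w ∉ S` and `ι_w(g_w) ∈ U` for the bad places `w ∈ S`. [folklore] -/
theorem mem_subgroup_of_localComponent' {g : FiniteAdelicGL n K}
    (hgood : ∀ w, w ∉ 𝒰.bad → localComponent n K w g ∈
      valuedCongruenceSubgroup (Fin n) (1 : WithZero (Multiplicative ℤ)))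
    (hbad : ∀ w ∈ 𝒰.bad, ofLocal n K w (localComponent n K w g) ∈ 𝒰.subgroup) : g ∈ 𝒰.subgroup := by
  classical
  -- remove the bad components
  set B := 𝒰.bad_finite.toFinset with hB
  set b : FiniteAdelicGL n K := (B.toList.map fun w => ofLocal n K w (localComponent n K w g)).prod with hb
  have hbmem : b ∈ 𝒰.subgroup := by
    refine list_prod_mem fun x hx => ?_
    obtain ⟨w, hw, rfl⟩ := List.mem_map.1 hx
    exact hbad w (𝒰.bad_finite.mem_toFinset.1 (Finset.mem_toList.1 hw))
  have hbloc : ∀ w, localComponent n K w b = if w ∈ 𝒰.bad then localComponent n K w g else 1 := by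
    intro w
    rw [hb, localComponent_list_prod_ofLocal w (fun v => localComponent n K v g) B.toList (Finset.nodup_toList B)]
    simp only [Finset.mem_toList, hB, Set.Finite.mem_toFinset]
  have hg' : g * b⁻¹ ∈ 𝒰.subgroup := by
    refine mem_subgroup_of_localComponent 𝒰 (fun w hw => ?_) fun w hw => ?_
    · rw [map_mul, map_inv, hbloc, if_neg hw, inv_one, mul_one]; exact hgood w hw
    · rw [map_mul, map_inv, hbloc, if_pos hw, mul_inv_cancel]
  simpa using mul_mem hg' hbmem

end Literature.NumberTheory.Automorphic.BigHeckeGLn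

/-! ## Factorisation of a global scalar along the Hida tower -/

open Literature.NumberTheory.Automorphic Literature.NumberTheory.Automorphic.BigHeckeGLn
open NumberField IsDedekindDomain

namespace Literature.NumberTheory.Automorphic.BigHeckeGLn

noncomputable section

variable {n : ℕ} {K : Type} [Field K] [NumberField K]

/-! ### Local scalars and the order of a global element at a place -/

/-- The local scalar matrix `a · 1 ∈ GL_n(K_w)` of a global `a ∈ Kˣ`. [folklore] -/
def localScalar (w : HeightOneSpectrum (𝓞 K)) (a : Kˣ) : GL (Fin n) (w.adicCompletion K) :=
  glDiagonal n (w.adicCompletion K) fun _ =>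
    Units.map (algebraMap K (w.adicCompletion K) : K →* w.adicCompletion K) a

/-- The local component of the principal adelic scalar `a · 1` is the local scalar. [folklore] -/
theorem localComponent_globalEmbedding_scalar (w : HeightOneSpectrum (𝓞 K)) (a : Kˣ) :
    localComponent n K w (globalEmbedding n K (Matrix.GeneralLinearGroup.scalar (Fin n) a)) =
      localScalar w a := by
  refine Matrix.GeneralLinearGroup.ext fun i j => ?_
  change algebraMap K (w.adicCompletion K)
      (((Matrix.GeneralLinearGroup.scalar (Fin n) a : GL (Fin n) K) : Matrix (Fin n) (Fin n) K) i j) = _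
  rw [localScalar, coe_glDiagonal, Matrix.GeneralLinearGroup.coe_scalar, Matrix.scalar_apply,
    Matrix.diagonal_apply, Matrix.diagonal_apply]
  split_ifs
  · rfl
  · exact map_zero _

/-- The order `ord_w(u) ∈ ℕ` of `u ∈ 𝓞 K` at `w` (exponent of `w` in `(u)`). [folklore] -/
def ordAt (w : HeightOneSpectrum (𝓞 K)) (u : 𝓞 K) : ℕ :=
  (Associates.mk w.asIdeal).count (Associates.mk (Ideal.span {u})).factors

/-- `|u|_w = |ϖ_w|^{ord_w u}` in `K_w`. [folklore] -/
theorem valued_algebraMap_eq (w : HeightOneSpectrum (𝓞 K)) {u : 𝓞 K} (hu : u ≠ 0) :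
    Valued.v (algebraMap K (w.adicCompletion K) (u : K)) =
      WithZero.exp (-(ordAt w u : ℤ)) := by
  refine (HeightOneSpectrum.valuedAdicCompletion_eq_valuation' w (u : K)).trans ?_
  rw [HeightOneSpectrum.valuation_of_algebraMap, HeightOneSpectrum.intValuation_if_neg w hu]
  rfl

/-- `ord_w u ≠ 0` iff `w ∣ (u)`. [folklore] -/
theorem ordAt_ne_zero_iff (w : HeightOneSpectrum (𝓞 K)) {u : 𝓞 K} (hu : u ≠ 0) :
    ordAt w u ≠ 0 ↔ w.asIdeal ∣ Ideal.span {u} := by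
  have h0 : Ideal.span {u} ≠ 0 := by
    rw [Ne, Ideal.zero_eq_bot, Ideal.span_singleton_eq_bot]; exact hu
  exact Associates.count_ne_zero_iff_dvd h0 w.irreducible

/-- The valuation of the fixed uniformiser: `|ϖ_w| = exp(-1)`. [folklore] -/
theorem valued_coe_uniformizerAt (w : HeightOneSpectrum (𝓞 K)) :
    Valued.v ((uniformizerAt w : (w.adicCompletion K)ˣ) : w.adicCompletion K) = WithZero.exp (-1 : ℤ) := by
  unfold uniformizerAt
  rw [Units.val_mk0]
  exact (HeightOneSpectrum.valuedAdicCompletion_eq_valuation' w _).trans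
    (Classical.choose_spec (w.valuation_exists_uniformizer K))

/-- The cut torus element with the full cut is the scalar `ϖ · 1`. [folklore] -/
theorem cutDiag_self (F : Type*) [Field F] (ϖ : Fˣ) :
    (cutDiag ϖ n : GL (Fin n) F) = glDiagonal n F fun _ => ϖ := by
  unfold cutDiag
  congr 1
  funext k
  rw [if_pos k.isLt]

variable {p : ℕ} [Fact p.Prime] (𝒰 : TameLevel n K p)

variable (K p) in
/-- The (finite) set of places of `K` above `p`, as a `Finset`. [folklore] -/
def placesAbove : Finset (HeightOneSpectrum (𝓞 K)) :=
  (finite_setOf_natCast_mem_asIdeal K p).toFinset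

omit 𝒰 in
/-- Membership in `placesAbove`. [folklore] -/
@[simp]
theorem mem_placesAbove {v : HeightOneSpectrum (𝓞 K)} : v ∈ placesAbove K p ↔ (p : 𝓞 K) ∈ v.asIdeal := by
  rw [placesAbove, Set.Finite.mem_toFinset]; rfl

open scoped Classical in
/-- The local diamond `diag(û_v, …, û_v) ∈ GL_n(K_v)` above `p` (and `1` off `p`). [folklore] -/
def diamondLocal (û : ∀ v : HeightOneSpectrum (𝓞 K), (p : 𝓞 K) ∈ v.asIdeal → (v.adicCompletionIntegers K)ˣ)
    (v : HeightOneSpectrum (𝓞 K)) : GL (Fin n) (v.adicCompletion K) :=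
  if hv : (p : 𝓞 K) ∈ v.asIdeal then glDiagonal n (v.adicCompletion K) (unitsToLocal n v fun _ => û v hv) else 1

omit [Fact p.Prime] 𝒰 in
/-- Above `p`, `ι_v` of the local diamond is the diamond element `⟨(û_v, …, û_v)⟩_v`. [folklore] -/
theorem ofLocal_diamondLocal (û : ∀ v : HeightOneSpectrum (𝓞 K), (p : 𝓞 K) ∈ v.asIdeal → (v.adicCompletionIntegers K)ˣ)
    {v : HeightOneSpectrum (𝓞 K)} (hv : (p : 𝓞 K) ∈ v.asIdeal) :
    ofLocal n K v (diamondLocal û v) = diamondElement n K v (fun _ : Fin n => û v hv) := by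
  rw [diamondLocal, dif_pos hv]; rfl

/-- **The diamond part** `D = ∏_{v ∣ p} ⟨(û_v, …, û_v)⟩_v` of the factorisation. [folklore] -/
def diamondPart (û : ∀ v : HeightOneSpectrum (𝓞 K), (p : 𝓞 K) ∈ v.asIdeal → (v.adicCompletionIntegers K)ˣ) :
    FiniteAdelicGL n K :=
  ((placesAbove K p).toList.map fun v => ofLocal n K v (diamondLocal û v)).prod

omit 𝒰 in
/-- Local components of the diamond part. [folklore] -/
theorem localComponent_diamondPart
    (û : ∀ v : HeightOneSpectrum (𝓞 K), (p : 𝓞 K) ∈ v.asIdeal → (v.adicCompletionIntegers K)ˣ)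
    (w : HeightOneSpectrum (𝓞 K)) : localComponent n K w (diamondPart (n := n) û) = diamondLocal û w := by
  classical
  rw [diamondPart, localComponent_list_prod_ofLocal w (diamondLocal û) _ (Finset.nodup_toList _)]
  split_ifs with h
  · rfl
  · rw [Finset.mem_toList, mem_placesAbove] at h
    rw [diamondLocal, dif_neg h]

/-- The local central element `(ϖ_w · 1)^{ord_w u} ∈ GL_n(K_w)`. [folklore] -/
def centralLocal (u : 𝓞 K) (w : HeightOneSpectrum (𝓞 K)) : GL (Fin n) (w.adicCompletion K) :=
  cutDiag (uniformizerAt w) n ^ ordAt w u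

omit 𝒰 in
/-- `ι_w` of the local central element is `t_{w,n}^{ord_w u}`. [folklore] -/
theorem ofLocal_centralLocal (u : 𝓞 K) (w : HeightOneSpectrum (𝓞 K)) :
    ofLocal n K w (centralLocal u w) = heckeElement n K w n ^ ordAt w u := by
  rw [centralLocal, map_pow, heckeElement_eq_ofLocal_cutDiag]

/-- The good places dividing `u` (a `Finset`). [folklore] -/
def goodSupport (u : 𝓞 K) (hu : u ≠ 0) : Finset (HeightOneSpectrum (𝓞 K)) :=
  letI := Classical.decPred fun w : HeightOneSpectrum (𝓞 K) => w ∉ 𝒰.bad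
  (Ideal.finite_factors (I := Ideal.span {u})
    (by rw [Ne, Ideal.zero_eq_bot, Ideal.span_singleton_eq_bot]; exact hu)).toFinset.filter fun w => w ∉ 𝒰.bad

/-- Membership in `goodSupport`. [folklore] -/
theorem mem_goodSupport {u : 𝓞 K} (hu : u ≠ 0) {w : HeightOneSpectrum (𝓞 K)} :
    w ∈ goodSupport 𝒰 u hu ↔ ordAt w u ≠ 0 ∧ w ∉ 𝒰.bad := by
  letI := Classical.decPred fun w : HeightOneSpectrum (𝓞 K) => w ∉ 𝒰.bad
  rw [goodSupport, Finset.mem_filter, Set.Finite.mem_toFinset, Set.mem_setOf_eq, ordAt_ne_zero_iff w hu]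

/-- **The central part** `C = ∏_{w ∣ u, w ∉ S} t_{w,n}^{ord_w u}`. [folklore] -/
def centralPart (u : 𝓞 K) (hu : u ≠ 0) : FiniteAdelicGL n K :=
  ((goodSupport 𝒰 u hu).toList.map fun w => ofLocal n K w (centralLocal u w)).prod

/-- Local components of the central part at the good places. [folklore] -/
theorem localComponent_centralPart_of_not_mem {u : 𝓞 K} (hu : u ≠ 0) {w : HeightOneSpectrum (𝓞 K)}
    (hw : w ∉ 𝒰.bad) : localComponent n K w (centralPart 𝒰 u hu) = centralLocal u w := by
  classical
  rw [centralPart, localComponent_list_prod_ofLocal w (centralLocal u) _ (Finset.nodup_toList _)]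
  split_ifs with h
  · rfl
  · rw [Finset.mem_toList, mem_goodSupport, not_and_or, not_not] at h
    rcases h with h | h
    · rw [centralLocal, h, pow_zero]
    · exact absurd hw h

/-- Local components of the central part at the bad places are trivial. [folklore] -/
theorem localComponent_centralPart_of_mem {u : 𝓞 K} (hu : u ≠ 0) {w : HeightOneSpectrum (𝓞 K)}
    (hw : w ∈ 𝒰.bad) : localComponent n K w (centralPart 𝒰 u hu) = 1 := by
  classical
  rw [centralPart, localComponent_list_prod_ofLocal w (centralLocal u) _ (Finset.nodup_toList _), if_neg]
  rw [Finset.mem_toList, mem_goodSupport, not_and_or, not_not]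
  exact Or.inr (not_not.2 hw)

/-- The global unit of `K` underlying a non-zero integer. [folklore] -/
def unitOf (u : 𝓞 K) (hu : u ≠ 0) : Kˣ :=
  Units.mk0 (u : K) (by exact_mod_cast hu)

/-- **The remainder** `y = C⁻¹ D⁻¹ z` of the factorisation of `z = u · 1`. [folklore] -/
def scalarRemainder (u : 𝓞 K) (hu : u ≠ 0)
    (û : ∀ v : HeightOneSpectrum (𝓞 K), (p : 𝓞 K) ∈ v.asIdeal → (v.adicCompletionIntegers K)ˣ) :
    FiniteAdelicGL n K :=
  (centralPart 𝒰 u hu)⁻¹ * (diamondPart û)⁻¹ *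
    globalEmbedding n K (Matrix.GeneralLinearGroup.scalar (Fin n) (unitOf u hu))

/-- **The factorisation** `z = D · C · y` of the principal adelic scalar `z = u · 1`. [folklore] -/
theorem globalEmbedding_scalar_eq (u : 𝓞 K) (hu : u ≠ 0)
    (û : ∀ v : HeightOneSpectrum (𝓞 K), (p : 𝓞 K) ∈ v.asIdeal → (v.adicCompletionIntegers K)ˣ) :
    globalEmbedding n K (Matrix.GeneralLinearGroup.scalar (Fin n) (unitOf u hu)) =
      diamondPart û * centralPart 𝒰 u hu * scalarRemainder 𝒰 u hu û := by
  rw [scalarRemainder]; group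

/-- Above `p` the remainder is trivial. [folklore] -/
theorem localComponent_scalarRemainder_of_mem {u : 𝓞 K} (hu : u ≠ 0)
    {û : ∀ v : HeightOneSpectrum (𝓞 K), (p : 𝓞 K) ∈ v.asIdeal → (v.adicCompletionIntegers K)ˣ}
    (hû : ∀ (v : HeightOneSpectrum (𝓞 K)) (hv : (p : 𝓞 K) ∈ v.asIdeal),
      ((û v hv : v.adicCompletionIntegers K) : v.adicCompletion K) = algebraMap K (v.adicCompletion K) (u : K))
    {v : HeightOneSpectrum (𝓞 K)} (hv : (p : 𝓞 K) ∈ v.asIdeal) :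
    localComponent n K v (scalarRemainder 𝒰 u hu û) = 1 := by
  have hD : diamondLocal (n := n) û v = localScalar v (unitOf u hu) := by
    rw [diamondLocal, dif_pos hv, localScalar]
    congr 1
    funext j
    exact Units.ext (hû v hv)
  rw [scalarRemainder, map_mul, map_mul, map_inv, map_inv, localComponent_diamondPart,
    localComponent_centralPart_of_mem 𝒰 hu (𝒰.mem_bad_of_mem v hv), localComponent_globalEmbedding_scalar,
    hD, inv_one, one_mul, inv_mul_cancel]

/-- At a good place the remainder is a UNIT scalar, hence in `GL_n(𝒪_w)`. [folklore] -/
theorem localComponent_scalarRemainder_mem_of_not_mem {u : 𝓞 K} (hu : u ≠ 0)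
    (û : ∀ v : HeightOneSpectrum (𝓞 K), (p : 𝓞 K) ∈ v.asIdeal → (v.adicCompletionIntegers K)ˣ)
    {w : HeightOneSpectrum (𝓞 K)} (hw : w ∉ 𝒰.bad) :
    localComponent n K w (scalarRemainder 𝒰 u hu û) ∈
      valuedCongruenceSubgroup (Fin n) (1 : WithZero (Multiplicative ℤ)) := by
  have hp : (p : 𝓞 K) ∉ w.asIdeal := fun h => hw (𝒰.mem_bad_of_mem w h)
  rw [scalarRemainder, map_mul, map_mul, map_inv, map_inv, localComponent_diamondPart,
    localComponent_centralPart_of_not_mem 𝒰 hu hw, localComponent_globalEmbedding_scalar, diamondLocal,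
    dif_neg hp, inv_one, mul_one, centralLocal, cutDiag_self, localScalar, ← map_pow, ← map_inv, ← map_mul]
  refine glDiagonal_mem_valuedCongruenceSubgroup_one_of_eq_one fun j => ?_
  rw [Pi.mul_apply, Pi.inv_apply, Pi.pow_apply, Units.val_mul, Units.val_inv_eq_inv_val, Units.val_pow_eq_pow_val,
    map_mul, map_inv₀, map_pow, valued_coe_uniformizerAt, Units.coe_map, MonoidHom.coe_coe]
  change _ * Valued.v (algebraMap K (w.adicCompletion K) (u : K)) = 1
  rw [valued_algebraMap_eq w hu, ← WithZero.exp_nsmul, ← WithZero.exp_neg, ← WithZero.exp_add]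
  simp

/-- At a bad place off `p` the remainder is the local scalar `u · 1`. [folklore] -/
theorem localComponent_scalarRemainder_of_mem_bad {u : 𝓞 K} (hu : u ≠ 0)
    (û : ∀ v : HeightOneSpectrum (𝓞 K), (p : 𝓞 K) ∈ v.asIdeal → (v.adicCompletionIntegers K)ˣ)
    {w : HeightOneSpectrum (𝓞 K)} (hw : w ∈ 𝒰.bad) (hp : (p : 𝓞 K) ∉ w.asIdeal) :
    localComponent n K w (scalarRemainder 𝒰 u hu û) = localScalar w (unitOf u hu) := by
  rw [scalarRemainder, map_mul, map_mul, map_inv, map_inv, localComponent_diamondPart,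
    localComponent_centralPart_of_mem 𝒰 hu hw, localComponent_globalEmbedding_scalar, diamondLocal,
    dif_neg hp, inv_one, one_mul, one_mul]

/-- **The remainder lies in every Hida level `U(r)`** (given `ι_w(u · 1) ∈ U` at the bad places off
`p` and `û_v = u` above `p`). [folklore] -/
theorem scalarRemainder_mem_hidaLevel {u : 𝓞 K} (hu : u ≠ 0)
    {û : ∀ v : HeightOneSpectrum (𝓞 K), (p : 𝓞 K) ∈ v.asIdeal → (v.adicCompletionIntegers K)ˣ}
    (hû : ∀ (v : HeightOneSpectrum (𝓞 K)) (hv : (p : 𝓞 K) ∈ v.asIdeal),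
      ((û v hv : v.adicCompletionIntegers K) : v.adicCompletion K) = algebraMap K (v.adicCompletion K) (u : K))
    (hbad : ∀ w ∈ 𝒰.bad, (p : 𝓞 K) ∉ w.asIdeal → ofLocal n K w (localScalar w (unitOf u hu)) ∈ 𝒰.subgroup)
    (r : ℕ) : scalarRemainder 𝒰 u hu û ∈ 𝒰.hidaLevel r := by
  refine (𝒰.mem_hidaLevel_iff r _).2 ⟨?_, fun w hw => ?_⟩
  · refine mem_subgroup_of_localComponent' 𝒰 (fun w hw => localComponent_scalarRemainder_mem_of_not_mem 𝒰 hu û hw)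
      fun w hw => ?_
    by_cases hp : (p : 𝓞 K) ∈ w.asIdeal
    · rw [localComponent_scalarRemainder_of_mem 𝒰 hu hû hp, map_one]; exact one_mem _
    · rw [localComponent_scalarRemainder_of_mem_bad 𝒰 hu û hw hp]; exact hbad w hw hp
  · rw [localComponent_scalarRemainder_of_mem 𝒰 hu hû hw]; exact one_mem _

end

end Literature.NumberTheory.Automorphic.BigHeckeGLn
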